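import Literature.NumberTheory.EllipticCurves.SelmerTorsionRelModelAction
import Literature.NumberTheory.EllipticCurves.QuadraticTwistSelmerPInfty
import Literature.NumberTheory.EllipticCurves.LocalKummerIsotropyTransport
import HarnessLib

/-!
# Transport of `H¹(F, E[n])`, `Sel^(n)` and the `Aut`-action along an equality of Weierstrass equations;
# the double base change `(W⁄K)⁄L = W⁄L` at finite level

Finite-level (`E[n]`-coefficients) twin of the `Congr` section of
`Literature.NumberTheory.EllipticCurves.BSDSelmerParityDokchitserProp417VerbatimProofs`
(`primaryCongr`, `h1PrimaryCongr`, `mem_selmerGroupPInfty_iff_h1PrimaryCongr_mem`, for `E[p^∞]`).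
For a field `F` and an EQUALITY `h : V₁ = V₂` of Weierstrass equations over `F` (the case in point is
the double base change `(W⁄K)⁄L = W⁄L` of a tower `k ⊂ K ⊂ L`, the tree's `baseChange_baseChange` /
`baseChange_baseChange_eq`), the identity on coordinates gives, with NO new definition (the tree's
`geomPointsCongr h`, `torsionByCongr`, `h1Equiv`):

* `torsionCongr_smul` — `torsionByCongr (geomPointsCongr h) n : E₁[n] ≃+ E₂[n]` is `Γ_F`-equivariant, so
  `h1Equiv (torsionByCongr (geomPointsCongr h) n) (torsionCongr_smul n h) : H¹(F, E₁[n]) ≃+ H¹(F, E₂[n])`;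
* `h1Equiv_torsionCongr_rfl` (it is the identity for `h = rfl`),
  `mem_selmerGroup_iff_h1Equiv_torsionCongr_mem` (**the `n`-Selmer groups correspond**),
  `h1Equiv_torsionCongr_resH1Hom` (maps of compatible pairs intertwined on coefficients correspond),
  `natCard_selmerGroup_congr`, `natCard_selmerGroup_fixed_congr` (counts of Selmer classes, and of Selmer
  classes fixed by intertwined endomorphisms, agree);
* the TOWER: for `W` over `k`, `k ⊂ K ⊂ L` and `σ ∈ Aut(L/K)`, the action `conjAct (W⁄K) σ n` on
  `H¹(L, (E_K)_L[n])` and the action `conjAct W (σ|_k) n` on `H¹(L, E_L[n])` (both through the same lift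
  `liftAut σ` of `σ` to `L̄`, the tree's `liftAut_restrictScalars`) CORRESPOND under the transport along `h : (W⁄K)⁄L = W⁄L`
  (`torsionCongr_torsionMap`, **`h1Equiv_torsionCongr_conjAct`**), whence
  **`natCard_selmerGroup_fixed_conjAct_tower`**:
  `#{y ∈ Sel^(n)((E_K)_L/L) : σ · y = y} = #{x ∈ Sel^(n)(E_L/L) : σ|_k · x = x}` and
  `natCard_selmerGroup_tower` : `#Sel^(n)((E_K)_L/L) = #Sel^(n)(E_L/L)`.

This is the bookkeeping that lets the relative (base `K`) finite-level descent of
`SelmerTorsionRelModelAction` be read on the Selmer group of `E_L = W⁄L` of a curve `W/k` defined over the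
bottom of the tower, where the `Aut(L/k)`-action lives (Dokchitser–Dokchitser 2010, Lemma 4.14 /
Cor. 4.15: `X_p(E/F)` as a `Gal(F/K)`-module for the intermediate fields of `F/k`). Everything here is
proved; no named fact, no definition is introduced.

## References

* T. Dokchitser, V. Dokchitser, Ann. of Math. 172 (2010), Lemma 4.14, Cor. 4.15.
  [DokchitserDokchitserAnnals2010]
* J.-P. Serre, *Galois Cohomology* (1997), I.§2.4 (compatible pairs), II.§1.1. [SerreGaloisCohomology1997]
* J. H. Silverman, *The Arithmetic of Elliptic Curves*, 2nd ed. (2009), X.§4 (the `n`-Selmer group).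
  [SilvermanAEC2009]
-/

noncomputable section

open scoped Classical

universe u v

namespace Literature.NumberTheory.EllipticCurves

open GaloisRepresentations WeierstrassCurve

/-! ## Transport of `H¹(F, E[n])` and `Sel^(n)` along `V₁ = V₂` -/

section Congr

variable {F : Type u} [Field F] {V₁ V₂ : WeierstrassCurve F} (n : ℤ)

/-- `E₁[n] ≃+ E₂[n]` along `V₁ = V₂` (the tree's `torsionByCongr (geomPointsCongr h) n`, identity on
coordinates) is `Γ_F`-equivariant. [cite: SerreGaloisCohomology1997, I.§2.4 (compatible pairs)] -/
theorem torsionCongr_smul (h : V₁ = V₂) (g : Field.absoluteGaloisGroup F) (P : geomTorsion V₁ n) :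
    torsionByCongr (geomPointsCongr h) n (g • P) = g • torsionByCongr (geomPointsCongr h) n P := by
  subst h; rfl

/-- Values of the torsion transport on underlying points. [cite: SerreGaloisCohomology1997, II.§1.1] -/
theorem coe_torsionCongr (h : V₁ = V₂) (P : geomTorsion V₁ n) :
    ((torsionByCongr (geomPointsCongr h) n P : geomTorsion V₂ n) : geomPoints V₂) =
      geomPointsCongr h (P : geomPoints V₁) :=
  rfl

/-- For `h = rfl` the torsion transport is the identity. [cite: SerreGaloisCohomology1997, II.§1.1] -/
@[simp]
theorem torsionCongr_rfl (P : geomTorsion V₁ n) :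
    torsionByCongr (geomPointsCongr (rfl : V₁ = V₁)) n P = P :=
  rfl

/-- **`H¹(F, E₁[n]) ≃+ H¹(F, E₂[n])` along `V₁ = V₂` is the identity for `h = rfl`** (the transport is
`h1Equiv (torsionByCongr (geomPointsCongr h) n) (torsionCongr_smul n h)`).
[cite: SerreGaloisCohomology1997, I.§2.4 (compatible pairs)] -/
theorem h1Equiv_torsionCongr_rfl (s : galH1Torsion V₁ n) :
    h1Equiv (torsionByCongr (geomPointsCongr (rfl : V₁ = V₁)) n) (torsionCongr_smul n rfl) s = s := by
  rw [h1Equiv_apply]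
  have e : resH1Hom (ContinuousMonoidHom.id (Field.absoluteGaloisGroup F))
      ((torsionByCongr (geomPointsCongr (rfl : V₁ = V₁)) n :
        geomTorsion V₁ n ≃+ geomTorsion V₁ n) : geomTorsion V₁ n →+ geomTorsion V₁ n)
        (torsionCongr_smul n rfl) =
      resH1Hom (ContinuousMonoidHom.id _) (AddMonoidHom.id _) (fun _ _ ↦ rfl) :=
    resH1Hom_congr rfl (by ext P; rfl) _ _
  rw [e, resH1Hom_id]
  rfl

/-- **The `n`-Selmer groups correspond along `V₁ = V₂`.** [cite: SilvermanAEC2009, X.§4] -/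
theorem mem_selmerGroup_iff_h1Equiv_torsionCongr_mem [NumberField F] (h : V₁ = V₂)
    (s : galH1Torsion V₁ n) :
    s ∈ selmerGroup V₁ n ↔
      h1Equiv (torsionByCongr (geomPointsCongr h) n) (torsionCongr_smul n h) s ∈ selmerGroup V₂ n := by
  subst h; rw [h1Equiv_torsionCongr_rfl]

/-- **Maps of compatible pairs intertwined by the torsion transport correspond under the `H¹`
transport.** [cite: SerreGaloisCohomology1997, I.§2.4 (compatible pairs)] -/
theorem h1Equiv_torsionCongr_resH1Hom (h : V₁ = V₂)
    {φ₁ φ₂ : Field.absoluteGaloisGroup F →ₜ* Field.absoluteGaloisGroup F} (hφ : φ₁ = φ₂)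
    (f₁ : geomTorsion V₁ n →+ geomTorsion V₁ n)
    (hf₁ : ∀ (x : Field.absoluteGaloisGroup F) (m : geomTorsion V₁ n), f₁ (φ₁ x • m) = x • f₁ m)
    (f₂ : geomTorsion V₂ n →+ geomTorsion V₂ n)
    (hf₂ : ∀ (x : Field.absoluteGaloisGroup F) (m : geomTorsion V₂ n), f₂ (φ₂ x • m) = x • f₂ m)
    (hc : ∀ P, torsionByCongr (geomPointsCongr h) n (f₁ P) = f₂ (torsionByCongr (geomPointsCongr h) n P))
    (s : galH1Torsion V₁ n) :
    h1Equiv (torsionByCongr (geomPointsCongr h) n) (torsionCongr_smul n h) (resH1Hom φ₁ f₁ hf₁ s) =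
      resH1Hom φ₂ f₂ hf₂ (h1Equiv (torsionByCongr (geomPointsCongr h) n) (torsionCongr_smul n h) s) := by
  subst h hφ
  have hf : f₁ = f₂ := AddMonoidHom.ext fun P ↦ by simpa using hc P
  subst hf
  rw [h1Equiv_torsionCongr_rfl, h1Equiv_torsionCongr_rfl]

/-- **`#Sel^(n)(V₁/F) = #Sel^(n)(V₂/F)` along `V₁ = V₂`.** [cite: SilvermanAEC2009, X.§4] -/
theorem natCard_selmerGroup_congr [NumberField F] (h : V₁ = V₂) :
    Nat.card (selmerGroup V₁ n) = Nat.card (selmerGroup V₂ n) := by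
  subst h; rfl

/-- **Counts of Selmer classes fixed by intertwined endomorphisms agree along `V₁ = V₂`**: if
`f₂ ∘ congr = congr ∘ f₁` on `H¹` then `#{y ∈ Sel^(n)(V₁) : f₁ y = y} = #{x ∈ Sel^(n)(V₂) : f₂ x = x}`.
[cite: DokchitserDokchitserAnnals2010, Lemma 4.14] -/
theorem natCard_selmerGroup_fixed_congr [NumberField F] (h : V₁ = V₂)
    (f₁ : galH1Torsion V₁ n →+ galH1Torsion V₁ n) (f₂ : galH1Torsion V₂ n →+ galH1Torsion V₂ n)
    (hc : ∀ s, h1Equiv (torsionByCongr (geomPointsCongr h) n) (torsionCongr_smul n h) (f₁ s) =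
      f₂ (h1Equiv (torsionByCongr (geomPointsCongr h) n) (torsionCongr_smul n h) s)) :
    Nat.card {y : selmerGroup V₁ n // f₁ (y : galH1Torsion V₁ n) = y} =
      Nat.card {x : selmerGroup V₂ n // f₂ (x : galH1Torsion V₂ n) = x} := by
  subst h
  have hf : f₁ = f₂ := AddMonoidHom.ext fun s ↦ by
    simpa only [h1Equiv_torsionCongr_rfl] using hc s
  subst hf
  rfl

end Congr

/-! ## The tower `k ⊂ K ⊂ L`: `conjAct (W⁄K) σ` versus `conjAct W (σ|_k)` -/

section Tower

variable {k : Type v} [Field k] {K L : Type u} [Field K] [Field L] [Algebra k K] [Algebra k L]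
  [Algebra K L] [IsScalarTower k K L] (W : WeierstrassCurve k) (σ : L ≃ₐ[K] L) (n : ℤ)

/-- **On `n`-torsion points, the lift `τ` of `σ` acts compatibly with the transport along
`(W⁄K)⁄L = W⁄L`**: `congr (τ · P) = τ · congr P` (both are `(x, y) ↦ (τ x, τ y)` on coordinates).
[cite: SerreGaloisCohomology1997, I.§2.5] -/
theorem torsionCongr_torsionMap (h : (W.baseChange K).baseChange L = W.baseChange L)
    (P : geomTorsion ((W.baseChange K).baseChange L) n) :
    torsionByCongr (geomPointsCongr h) n ((isLiftOfAut_liftAut σ).torsionMap (W.baseChange K) n P) =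
      (isLiftOfAut_liftAut (σ.restrictScalars k)).torsionMap W n
        (torsionByCongr (geomPointsCongr h) n P) := by
  apply Subtype.ext
  rw [coe_torsionByCongr_apply, IsLiftOfAut.coe_torsionMap, IsLiftOfAut.coe_torsionMap,
    coe_torsionByCongr_apply]
  generalize (P : geomPoints ((W.baseChange K).baseChange L)) = Q
  change ((W.baseChange K).baseChange L |>.baseChange (AlgebraicClosure L)).toAffine.Point at Q
  rcases Q with _ | ⟨x, y, hQ⟩
  · change geomPointsCongr h ((isLiftOfAut_liftAut σ).pointsMap (W.baseChange K) 0) =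
      (isLiftOfAut_liftAut (σ.restrictScalars k)).pointsMap W (geomPointsCongr h 0)
    simp only [map_zero]
  · rw [geomPointsCongr_some h hQ]
    obtain ⟨h1, e1⟩ := RelModel.pointsMap_some (isLiftOfAut_liftAut σ) (W.baseChange K) hQ
    rw [e1, geomPointsCongr_some h h1]
    rfl

/-- **The `Aut`-actions correspond along `(W⁄K)⁄L = W⁄L`**: for `σ ∈ Aut(L/K)` and every class
`y ∈ H¹(L, (E_K)_L[n])`, `congr (σ · y) = σ|_k · congr y`, where `σ · y = conjAct (W⁄K) σ n y` and
`σ|_k · x = conjAct W (σ.restrictScalars k) n x` (both are induced by the compatible pair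
`(τ⁻¹ · τ, τ)` for the same lift `τ = liftAut σ`). [cite: DokchitserDokchitserAnnals2010, Lemma 4.14]
[cite: SerreGaloisCohomology1997, I.§2.5] -/
theorem h1Equiv_torsionCongr_conjAct (h : (W.baseChange K).baseChange L = W.baseChange L)
    (y : galH1Torsion ((W.baseChange K).baseChange L) n) :
    h1Equiv (torsionByCongr (geomPointsCongr h) n) (torsionCongr_smul n h)
        (conjAct (W.baseChange K) σ n y) =
      conjAct W (σ.restrictScalars k) n
        (h1Equiv (torsionByCongr (geomPointsCongr h) n) (torsionCongr_smul n h) y) :=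
  h1Equiv_torsionCongr_resH1Hom n h rfl _ _ _ _ (torsionCongr_torsionMap W σ n h) y

variable [NumberField L]

omit [IsScalarTower k K L] in
/-- **`#Sel^(n)((E_K)_L/L) = #Sel^(n)(E_L/L)`** along `(W⁄K)⁄L = W⁄L`. [cite: SilvermanAEC2009, X.§4] -/
theorem natCard_selmerGroup_tower (h : (W.baseChange K).baseChange L = W.baseChange L) :
    Nat.card (selmerGroup ((W.baseChange K).baseChange L) n) = Nat.card (selmerGroup (W.baseChange L) n) :=
  natCard_selmerGroup_congr n h

/-- **`#{y ∈ Sel^(n)((E_K)_L/L) : σ · y = y} = #{x ∈ Sel^(n)(E_L/L) : σ|_k · x = x}`** for `σ ∈ Aut(L/K)`: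
the `σ`-fixed Selmer classes of the double base change, counted with the relative action
`conjAct (W⁄K) σ`, are the `σ|_k`-fixed Selmer classes of `E_L` counted with `conjAct W (σ|_k)`.
[cite: DokchitserDokchitserAnnals2010, Lemma 4.14] -/
theorem natCard_selmerGroup_fixed_conjAct_tower (h : (W.baseChange K).baseChange L = W.baseChange L) :
    Nat.card {y : selmerGroup ((W.baseChange K).baseChange L) n //
        conjAct (W.baseChange K) σ n (y : galH1Torsion ((W.baseChange K).baseChange L) n) = y} =
      Nat.card {x : selmerGroup (W.baseChange L) n //
        conjAct W (σ.restrictScalars k) n (x : galH1Torsion (W.baseChange L) n) = x} :=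
  natCard_selmerGroup_fixed_congr n h _ _ (h1Equiv_torsionCongr_conjAct W σ n h)

end Tower

end Literature.NumberTheory.EllipticCurves
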